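import Summits.QuantumFields.YangMills.Theorems.BalabanUVNodesN19FejerMean
import Mathlib.Analysis.Real.Pi.Bounds
import Mathlib.Analysis.SpecialFunctions.Integrability.Basic

/-!
# YM-DAG node N19 (= NE7 proper) — THE JACKSON KERNEL `f_L²` AND ITS MEAN OF A PERIODIC LIPSCHITZ FUNCTION
# (a trigonometric polynomial with modes `≤ 2L − 2` within `3π⁵Λ∕(32L)` — NO `log L` — with the SAME Lipschitz constant)

Cell `pub-ymgap`, HUMAN RULING D-0062 (Track A) ∕ D-0149 (work-bound push), R141 (C) wider-strategy seat `pub-ymgap-dag-n19-e` (strategy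
s3 = ALTERNATIVE CURRENCY), generation g33, module 18 (lineage module 165).  Route `Summits/QuantumFields/YangMills/Theses/BalabanUVNodes.lean`,
cluster item K3⁸ «SpineGivenEndpointR13SepCoPHV» (stmt-QuantumFields-27366); filed `--supports` that item `--as helper` (it proves no registered
stub).  COUNT-NEUTRAL: [folklore] one-dimensional harmonic analysis over Mathlib (`integral_zpow`, `Real.mul_le_sin`, `Real.sin_le`) and, BY NAME,
`Literature.Probability.LatticeModels.FejerKernel` (`fejerKernel_le`, `fejerKernel_le_div_sq`, `norm_dirichletSum_eq`) and module 150 `…N19FejerMean`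
(`fejerKernel_eq_doubleSum`, `cos_natAbs_mul`, `continuous_fejerKernel`, `fejerKernel_neg`, `integral_shift_cos_natMul`, `abs_fourierCoeff_le`); no laws,
no scheme object, no Theses import; NOT a discharge claim.

ROLE IN THE LINEAGE.  Module 150's FEJÉR mean pays `Λπ(1 + log L)∕L` on a `Λ`-Lipschitz function — one of the three logarithms of module 152b's
`10⁴·K·d·log₂³t∕t` is this Lebesgue constant.  The JACKSON kernel `f_L(v)²` (normalised by `Z_L = ∫_{−π}^{π} f_L²`) removes it:
(§1) `f_L² = (1∕2L²)·Σ_{q ∈ (range L)⁴}(cos(k⁺_q v) + cos(k⁻_q v))` with natural modes `k⁺_q = |n−m| + |n′−m′| ≤ 2L − 2`, `k⁻_q = ||n−m| − |n′−m′||`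
(`cos A cos B = ½(cos(A+B) + cos(A−B))`); `Z_L ≥ 32L∕π³` (`f_L ≥ 4L∕π²` on `|v| ≤ π∕L` by Jordan's inequality in the closed form
`|sin(Lv∕2)|∕|sin(v∕2)|`); `∫_{−π}^{π}|v|f_L(v)² dv ≤ 3π²` (`f_L ≤ L` on `|v| ≤ π∕L`, `f_L² ≤ π⁴∕(L²v⁴)` beyond, `∫_{π∕L}^{π} v^{−3} ≤ L²∕(2π²)`);
(§2) the Jackson mean `T(θ) = (1∕Z_L)∫f(θ − v)f_L(v)²dv` is a trigonometric polynomial with those modes (`jacksonMean_eq_trigSum`), within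
`Λ·3π⁵∕(32L)` of `f` EVERYWHERE (`abs_jacksonMean_sub_le`) — NO LOGARITHM — and `Λ`-Lipschitz (`abs_jacksonMean_sub_jacksonMean_le`).  The sequel
(`…N19JacksonSteklovSmoothing`) box-averages it exactly as module 150b and feeds modules 151∕152: the degree-model row drops from `log³` to `log²`.

HONEST FRAMING (binding).  Elementary and [folklore] (D. Jackson 1911; constants crude: `3π⁵∕32 ≈ 28.7` against the classical `≈ 3`); NO consumer in the
DAG today (a step of an optimality map of the seat's own currency, degree model); nothing of Bałaban's instantiated; NE7 NOT PRINTED, NOT proved; N19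
NOT discharged; count-neutral.  One finite `T⁴` programme at fixed `ε`; nothing continuum ∕ `ℝ⁴` ∕ OS ∕ mass-gap ∕ Clay.  0 `def` ∕ 0 `sorry`.
-/

noncomputable section

open Finset MeasureTheory intervalIntegral
open scoped Real

namespace Summit.QuantumFields.YangMills.Theorems.BalabanUVNodesN19JacksonKernelMean

open Literature.Probability.LatticeModels (fejerKernel dirichletSum fejerKernel_nonneg fejerKernel_le fejerKernel_le_div_sq norm_dirichletSum_eq)
open Summit.QuantumFields.YangMills.Theorems.BalabanUVNodesN19FejerMean
  (fejerKernel_eq_doubleSum cos_natAbs_mul continuous_fejerKernel fejerKernel_neg integral_shift_cos_natMul abs_fourierCoeff_le)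

/-! ## §1 The Jackson kernel `f_L²`: modes, mass from below, first absolute moment [folklore] -/

/-- **THE JACKSON KERNEL AS A QUADRUPLE COSINE SUM WITH NATURAL MODES.**  With `a_q = |n − m|`, `b_q = |n′ − m′|` for `q = ((n,m),(n′,m′))`:
`f_L(v)² = (1∕(2L²))·Σ_{q ∈ (range L × range L)²} (cos((a_q + b_q)v) + cos(|a_q − b_q|v))`. [folklore] -/
theorem fejerKernel_sq_eq_quadSum (L : ℕ) (v : ℝ) :
    fejerKernel L v ^ 2 = (∑ q ∈ (range L ×ˢ range L) ×ˢ (range L ×ˢ range L),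
      (Real.cos (((((q.1.1 : ℤ) - q.1.2).natAbs + ((q.2.1 : ℤ) - q.2.2).natAbs : ℕ) : ℝ) * v) +
        Real.cos ((((((q.1.1 : ℤ) - q.1.2).natAbs : ℤ) - ((q.2.1 : ℤ) - q.2.2).natAbs).natAbs : ℝ) * v))) / (2 * L ^ 2) := by
  have hD : fejerKernel L v = (∑ p ∈ range L ×ˢ range L, Real.cos ((((p.1 : ℤ) - p.2).natAbs : ℕ) * v)) / L := by
    rw [fejerKernel_eq_doubleSum, Finset.sum_product]
  have hterm : ∀ q : (ℕ × ℕ) × (ℕ × ℕ),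
      Real.cos (((((q.1.1 : ℤ) - q.1.2).natAbs + ((q.2.1 : ℤ) - q.2.2).natAbs : ℕ) : ℝ) * v) +
        Real.cos ((((((q.1.1 : ℤ) - q.1.2).natAbs : ℤ) - ((q.2.1 : ℤ) - q.2.2).natAbs).natAbs : ℝ) * v) =
      2 * (Real.cos ((((q.1.1 : ℤ) - q.1.2).natAbs : ℕ) * v) * Real.cos ((((q.2.1 : ℤ) - q.2.2).natAbs : ℕ) * v)) := by
    intro q
    rw [cos_natAbs_mul, Real.cos_sub]
    push_cast
    rw [add_mul, Real.cos_add]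
    ring
  rw [Finset.sum_congr rfl fun q _ => hterm q, ← Finset.mul_sum, hD, div_pow, sq (∑ p ∈ range L ×ˢ range L, _),
    Finset.sum_mul_sum, ← Finset.sum_product']
  rcases Nat.eq_zero_or_pos L with hL0 | hLpos
  · subst hL0; simp
  · have hLr : (L : ℝ) ≠ 0 := by exact_mod_cast hLpos.ne'
    field_simp
    exact Finset.sum_congr rfl fun q _ => by ring_nf

/-- `f_L ≥ 4L∕π²` for `0 < v ≤ π∕L` (Jordan: `|sin(Lv∕2)| ≥ Lv∕π`, `sin(v∕2) ≤ v∕2`). [folklore] -/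
theorem fejerKernel_ge_of_pos {L : ℕ} (hL : 1 ≤ L) {v : ℝ} (hv0 : 0 < v) (hv : v ≤ π / L) :
    4 * L / π ^ 2 ≤ fejerKernel L v := by
  have hπ := Real.pi_pos
  have hLr : (0 : ℝ) < L := by exact_mod_cast hL
  have hvπ : v ≤ π := hv.trans (div_le_self hπ.le (by exact_mod_cast hL))
  have hs0 : 0 < Real.sin (v / 2) := Real.sin_pos_of_pos_of_lt_pi (by positivity) (by linarith)
  have hs1 : Real.sin (v / 2) ≤ v / 2 := Real.sin_le (by positivity)
  have hLv : L * v / 2 ≤ π / 2 := by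
    rw [div_le_div_iff_of_pos_right two_pos]
    calc (L : ℝ) * v ≤ L * (π / L) := mul_le_mul_of_nonneg_left hv hLr.le
      _ = π := by field_simp
  have hj : 2 / π * (L * v / 2) ≤ Real.sin (L * v / 2) := Real.mul_le_sin (by positivity) hLv
  have hsL : 0 ≤ Real.sin (L * v / 2) := le_trans (by positivity) hj
  have hq : 2 * L / π ≤ Real.sin (L * v / 2) / Real.sin (v / 2) := by
    rw [le_div_iff₀ hs0]
    have e : 2 / π * (L * v / 2) = L * v / π := by field_simp
    calc 2 * L / π * Real.sin (v / 2) ≤ 2 * L / π * (v / 2) := mul_le_mul_of_nonneg_left hs1 (by positivity)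
      _ = L * v / π := by ring
      _ ≤ Real.sin (L * v / 2) := by rw [← e]; exact hj
  unfold fejerKernel
  rw [norm_dirichletSum_eq hs0.ne', abs_of_nonneg hsL, abs_of_pos hs0]
  have h2 : (2 * L / π) ^ 2 ≤ (Real.sin (L * v / 2) / Real.sin (v / 2)) ^ 2 := pow_le_pow_left₀ (by positivity) hq 2
  calc 4 * (L : ℝ) / π ^ 2 = (2 * L / π) ^ 2 / L := by field_simp; ring
    _ ≤ (Real.sin (L * v / 2) / Real.sin (v / 2)) ^ 2 / L := div_le_div_of_nonneg_right h2 hLr.le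

/-- **THE MASS OF THE JACKSON KERNEL FROM BELOW**: `∫_{−π}^{π} f_L² ≥ 32L∕π³` (`L ≥ 1`). [folklore] -/
theorem le_integral_fejerKernel_sq {L : ℕ} (hL : 1 ≤ L) : 32 * L / π ^ 3 ≤ ∫ v in (-π)..π, fejerKernel L v ^ 2 := by
  have hπ := Real.pi_pos
  have hLr : (0 : ℝ) < L := by exact_mod_cast hL
  set a : ℝ := π / L with ha
  have ha0 : 0 < a := div_pos hπ hLr
  have haπ : a ≤ π := div_le_self hπ.le (by exact_mod_cast hL)
  have hcont : Continuous fun v : ℝ => fejerKernel L v ^ 2 := (continuous_fejerKernel L).pow 2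
  -- restrict to `[−a, a]`
  have hsub : ∫ v in (-a)..a, fejerKernel L v ^ 2 ≤ ∫ v in (-π)..π, fejerKernel L v ^ 2 :=
    intervalIntegral.integral_mono_interval (by linarith) (by linarith) haπ
      (ae_of_all _ fun v => by positivity) (hcont.intervalIntegrable _ _)
  -- on `(0, a]` and, by evenness, on `[−a, 0)`: `f² ≥ (4L/π²)²`; at `0` the integrand's value is irrelevant, so use `Ioo`-free bound via continuity:
  have hlow : ∀ v ∈ Set.Icc (-a) a, (4 * L / π ^ 2) ^ 2 ≤ fejerKernel L v ^ 2 := by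
    intro v hv
    have key : 4 * L / π ^ 2 ≤ fejerKernel L v := by
      rcases lt_trichotomy v 0 with hneg | hzero | hpos
      · have := fejerKernel_ge_of_pos hL (neg_pos.2 hneg) (by linarith [hv.1])
        rwa [fejerKernel_neg] at this
      · rw [hzero, Literature.Probability.LatticeModels.fejerKernel_zero]
        rw [div_le_iff₀ (by positivity)]
        have h3 : (3 : ℝ) < π := Real.pi_gt_three
        have : (4 : ℝ) ≤ π ^ 2 := by nlinarith [h3]
        nlinarith [this, hLr]
      · exact fejerKernel_ge_of_pos hL hpos hv.2
    exact pow_le_pow_left₀ (by positivity) key 2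
  have hconst : ∫ _v in (-a)..a, (4 * (L : ℝ) / π ^ 2) ^ 2 ≤ ∫ v in (-a)..a, fejerKernel L v ^ 2 :=
    intervalIntegral.integral_mono_on (by linarith) (by simp) (hcont.intervalIntegrable _ _) hlow
  rw [intervalIntegral.integral_const, smul_eq_mul] at hconst
  have e : (a - -a) * (4 * (L : ℝ) / π ^ 2) ^ 2 = 32 * L / π ^ 3 := by rw [ha]; field_simp; ring
  linarith [hconst, hsub, e.le, e.ge]

/-- **THE FIRST ABSOLUTE MOMENT OF THE JACKSON KERNEL**: `∫_{−π}^{π} |v|·f_L(v)² dv ≤ 3π²` (`L ≥ 1`) — NO `log L`. [folklore] -/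
theorem integral_abs_mul_fejerKernel_sq_le {L : ℕ} (hL : 1 ≤ L) :
    ∫ v in (-π)..π, |v| * fejerKernel L v ^ 2 ≤ 3 * π ^ 2 := by
  have hLr : (0 : ℝ) < L := by exact_mod_cast hL
  have hπ := Real.pi_pos
  set a : ℝ := π / L with ha
  have ha0 : 0 < a := div_pos hπ hLr
  have haπ : a ≤ π := div_le_self hπ.le (by exact_mod_cast hL)
  have hcont : Continuous fun v : ℝ => |v| * fejerKernel L v ^ 2 := continuous_abs.mul ((continuous_fejerKernel L).pow 2)
  have hii : ∀ b c : ℝ, IntervalIntegrable (fun v : ℝ => |v| * fejerKernel L v ^ 2) volume b c := fun b c => hcont.intervalIntegrable _ _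
  -- middle
  have hmid : ∫ v in (-a)..a, |v| * fejerKernel L v ^ 2 ≤ 2 * π ^ 2 := by
    have h1 : ∫ v in (-a)..a, |v| * fejerKernel L v ^ 2 ≤ ∫ _v in (-a)..a, a * L ^ 2 := by
      refine intervalIntegral.integral_mono_on (by linarith) (hii _ _) (by simp) fun v hv => ?_
      have hf : fejerKernel L v ^ 2 ≤ (L : ℝ) ^ 2 := pow_le_pow_left₀ (fejerKernel_nonneg L v) (fejerKernel_le L v) 2
      exact mul_le_mul (abs_le.2 ⟨by linarith [hv.1], hv.2⟩) hf (by positivity) ha0.le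
    rw [intervalIntegral.integral_const, smul_eq_mul] at h1
    have e : (a - -a) * (a * (L : ℝ) ^ 2) = 2 * π ^ 2 := by rw [ha]; field_simp; ring
    linarith [h1, e.le, e.ge]
  -- right tail
  have hright : ∫ v in a..π, |v| * fejerKernel L v ^ 2 ≤ π ^ 2 / 2 := by
    have h0a : (0 : ℝ) ∉ Set.uIcc a π := by
      rw [Set.uIcc_of_le haπ]; exact fun h => by linarith [h.1]
    have hI : ∫ v in a..π, v ^ (-3 : ℤ) = ((a ^ 2)⁻¹ - (π ^ 2)⁻¹) / 2 := by
      rw [integral_zpow (Or.inr ⟨by norm_num, h0a⟩)]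
      have e : (-3 : ℤ) + 1 = -2 := by norm_num
      rw [e, zpow_neg, zpow_neg, zpow_ofNat, zpow_ofNat]
      push_cast
      ring
    have h1 : ∫ v in a..π, |v| * fejerKernel L v ^ 2 ≤ ∫ v in a..π, (π ^ 4 / L ^ 2) * v ^ (-3 : ℤ) := by
      refine intervalIntegral.integral_mono_on haπ (hii _ _) ((intervalIntegral.intervalIntegrable_zpow (Or.inr h0a)).const_mul _)
        fun v hv => ?_
      have hv0 : 0 < v := ha0.trans_le hv.1
      have hd := fejerKernel_le_div_sq hL hv0.ne' (show |v| ≤ π by rw [abs_of_pos hv0]; exact hv.2)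
      rw [abs_of_pos hv0]
      have hf2 : fejerKernel L v ^ 2 ≤ (π ^ 2 / (L * v ^ 2)) ^ 2 := pow_le_pow_left₀ (fejerKernel_nonneg L v) hd 2
      calc v * fejerKernel L v ^ 2 ≤ v * (π ^ 2 / (L * v ^ 2)) ^ 2 := mul_le_mul_of_nonneg_left hf2 hv0.le
        _ = (π ^ 4 / L ^ 2) * v ^ (-3 : ℤ) := by
            rw [zpow_neg, zpow_ofNat]; field_simp
    rw [intervalIntegral.integral_const_mul, hI] at h1
    have e : π ^ 4 / (L : ℝ) ^ 2 * (((a ^ 2)⁻¹ - (π ^ 2)⁻¹) / 2) = π ^ 2 / 2 - π ^ 2 / (2 * L ^ 2) := by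
      rw [ha]; field_simp
    rw [e] at h1
    have hpos : 0 ≤ π ^ 2 / (2 * (L : ℝ) ^ 2) := by positivity
    linarith [h1, hpos]
  -- left tail by symmetry
  have hleft : ∫ v in (-π)..(-a), |v| * fejerKernel L v ^ 2 ≤ π ^ 2 / 2 := by
    have e : ∫ v in (-π)..(-a), |v| * fejerKernel L v ^ 2 = ∫ v in a..π, |v| * fejerKernel L v ^ 2 := by
      rw [← intervalIntegral.integral_comp_neg fun v => |v| * fejerKernel L v ^ 2]
      simp only [abs_neg, fejerKernel_neg]
    rw [e]; exact hright
  have hsplit : ∫ v in (-π)..π, |v| * fejerKernel L v ^ 2 =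
      (∫ v in (-π)..(-a), |v| * fejerKernel L v ^ 2) + ((∫ v in (-a)..a, |v| * fejerKernel L v ^ 2) +
        ∫ v in a..π, |v| * fejerKernel L v ^ 2) := by
    rw [intervalIntegral.integral_add_adjacent_intervals (hii _ _) (hii _ _),
      intervalIntegral.integral_add_adjacent_intervals (hii _ _) (hii _ _)]
  rw [hsplit]
  linarith [hleft, hmid, hright]

/-! ## §2 The Jackson mean of a periodic Lipschitz function [folklore] -/

/-- **THE JACKSON MEAN IS A TRIGONOMETRIC POLYNOMIAL WITH MODES `≤ 2L − 2`.**  For `f` continuous and `2π`-periodic and `Z ≠ 0`: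
`(1∕Z)∫_{−π}^{π} f(θ − v)f_L(v)² dv = Σ_{q} Σ_{k ∈ {k⁺_q, k⁻_q}} (1∕(2L²Z))(C_k cos(kθ) + S_k sin(kθ))`, written as a sum over `q ∈ (range L²)²` of the two
mode terms, `C_k = ∫f cos(k·)`, `S_k = ∫f sin(k·)`. [folklore] -/
theorem jacksonMean_eq_trigSum {f : ℝ → ℝ} (hfc : Continuous f) (hper : Function.Periodic f (2 * π)) (L : ℕ) (Z θ : ℝ) :
    (1 / Z) * ∫ v in (-π)..π, f (θ - v) * fejerKernel L v ^ 2 =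
      ∑ q ∈ (range L ×ˢ range L) ×ˢ (range L ×ˢ range L), (1 / (2 * L ^ 2 * Z)) *
        (((∫ w in (-π)..π, f w * Real.cos (((((q.1.1 : ℤ) - q.1.2).natAbs + ((q.2.1 : ℤ) - q.2.2).natAbs : ℕ) : ℝ) * w)) *
            Real.cos (((((q.1.1 : ℤ) - q.1.2).natAbs + ((q.2.1 : ℤ) - q.2.2).natAbs : ℕ) : ℝ) * θ) +
          (∫ w in (-π)..π, f w * Real.sin (((((q.1.1 : ℤ) - q.1.2).natAbs + ((q.2.1 : ℤ) - q.2.2).natAbs : ℕ) : ℝ) * w)) *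
            Real.sin (((((q.1.1 : ℤ) - q.1.2).natAbs + ((q.2.1 : ℤ) - q.2.2).natAbs : ℕ) : ℝ) * θ)) +
        ((∫ w in (-π)..π, f w * Real.cos ((((((q.1.1 : ℤ) - q.1.2).natAbs : ℤ) - ((q.2.1 : ℤ) - q.2.2).natAbs).natAbs : ℝ) * w)) *
            Real.cos ((((((q.1.1 : ℤ) - q.1.2).natAbs : ℤ) - ((q.2.1 : ℤ) - q.2.2).natAbs).natAbs : ℝ) * θ) +
          (∫ w in (-π)..π, f w * Real.sin ((((((q.1.1 : ℤ) - q.1.2).natAbs : ℤ) - ((q.2.1 : ℤ) - q.2.2).natAbs).natAbs : ℝ) * w)) *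
            Real.sin ((((((q.1.1 : ℤ) - q.1.2).natAbs : ℤ) - ((q.2.1 : ℤ) - q.2.2).natAbs).natAbs : ℝ) * θ))) := by
  set Q := (range L ×ˢ range L) ×ˢ (range L ×ˢ range L) with hQ
  have hfθ : Continuous fun v => f (θ - v) := hfc.comp (continuous_const.sub continuous_id)
  have h1 : (fun v => f (θ - v) * fejerKernel L v ^ 2) = fun v => (∑ q ∈ Q,
      (f (θ - v) * Real.cos (((((q.1.1 : ℤ) - q.1.2).natAbs + ((q.2.1 : ℤ) - q.2.2).natAbs : ℕ) : ℝ) * v) +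
        f (θ - v) * Real.cos ((((((q.1.1 : ℤ) - q.1.2).natAbs : ℤ) - ((q.2.1 : ℤ) - q.2.2).natAbs).natAbs : ℝ) * v))) /
      (2 * L ^ 2) := by
    funext v
    rw [fejerKernel_sq_eq_quadSum, mul_div_assoc', Finset.mul_sum]
    congr 1
    exact Finset.sum_congr rfl fun q _ => by ring
  have hintq : ∀ q : (ℕ × ℕ) × (ℕ × ℕ), IntervalIntegrable (fun v =>
      f (θ - v) * Real.cos (((((q.1.1 : ℤ) - q.1.2).natAbs + ((q.2.1 : ℤ) - q.2.2).natAbs : ℕ) : ℝ) * v) +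
        f (θ - v) * Real.cos ((((((q.1.1 : ℤ) - q.1.2).natAbs : ℤ) - ((q.2.1 : ℤ) - q.2.2).natAbs).natAbs : ℝ) * v)) volume (-π) π :=
    fun q => ((hfθ.mul (by fun_prop)).add (hfθ.mul (by fun_prop))).intervalIntegrable _ _
  have hint1 : ∀ q : (ℕ × ℕ) × (ℕ × ℕ), IntervalIntegrable (fun v =>
      f (θ - v) * Real.cos (((((q.1.1 : ℤ) - q.1.2).natAbs + ((q.2.1 : ℤ) - q.2.2).natAbs : ℕ) : ℝ) * v)) volume (-π) π :=
    fun q => (hfθ.mul (by fun_prop)).intervalIntegrable _ _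
  have hint2 : ∀ q : (ℕ × ℕ) × (ℕ × ℕ), IntervalIntegrable (fun v =>
      f (θ - v) * Real.cos ((((((q.1.1 : ℤ) - q.1.2).natAbs : ℤ) - ((q.2.1 : ℤ) - q.2.2).natAbs).natAbs : ℝ) * v)) volume (-π) π :=
    fun q => (hfθ.mul (by fun_prop)).intervalIntegrable _ _
  rw [h1, intervalIntegral.integral_div, intervalIntegral.integral_finsetSum fun q _ => hintq q]
  rw [Finset.sum_div, Finset.mul_sum]
  refine Finset.sum_congr rfl fun q _ => ?_
  rw [intervalIntegral.integral_add (hint1 q) (hint2 q), integral_shift_cos_natMul hfc hper, integral_shift_cos_natMul hfc hper]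
  rcases Nat.eq_zero_or_pos L with hL0 | hLpos
  · subst hL0; simp
  · have hLr : (L : ℝ) ≠ 0 := by exact_mod_cast hLpos.ne'
    by_cases hZ : Z = 0
    · subst hZ; simp
    · field_simp

/-- **THE JACKSON MEAN OF A LIPSCHITZ FUNCTION**: for `f` continuous, `2π`-periodic and `Λ`-Lipschitz on `ℝ` and `L ≥ 1`, with `Z = ∫_{−π}^{π}f_L²`:
`|(1∕Z)∫_{−π}^{π} f(θ − v)f_L(v)² dv − f(θ)| ≤ Λ·3π⁵∕(32L)` for every `θ` — NO LOGARITHM. [folklore] -/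
theorem abs_jacksonMean_sub_le {f : ℝ → ℝ} {Λ : ℝ} (hfc : Continuous f) (hΛ : ∀ a b, |f a - f b| ≤ Λ * |a - b|)
    {L : ℕ} (hL : 1 ≤ L) (θ : ℝ) :
    |(1 / ∫ v in (-π)..π, fejerKernel L v ^ 2) * (∫ v in (-π)..π, f (θ - v) * fejerKernel L v ^ 2) - f θ| ≤ Λ * (3 * π ^ 5 / (32 * L)) := by
  have hπ := Real.pi_pos
  have hLr : (0 : ℝ) < L := by exact_mod_cast hL
  set Z : ℝ := ∫ v in (-π)..π, fejerKernel L v ^ 2 with hZ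
  have hZlow := le_integral_fejerKernel_sq hL
  have hZ0 : 0 < Z := lt_of_lt_of_le (by positivity) hZlow
  have hΛ0 : 0 ≤ Λ := by
    have h1 : 0 ≤ Λ * |(1 : ℝ) - 0| := (abs_nonneg _).trans (hΛ 1 0)
    simpa using h1
  have hfθ : Continuous fun v => f (θ - v) := hfc.comp (continuous_const.sub continuous_id)
  have hK : Continuous fun v : ℝ => fejerKernel L v ^ 2 := (continuous_fejerKernel L).pow 2
  have hI1 : IntervalIntegrable (fun v => f (θ - v) * fejerKernel L v ^ 2) volume (-π) π := (hfθ.mul hK).intervalIntegrable _ _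
  have hI2 : IntervalIntegrable (fun v => f θ * fejerKernel L v ^ 2) volume (-π) π := (continuous_const.mul hK).intervalIntegrable _ _
  have hsub : ∫ v in (-π)..π, (f (θ - v) - f θ) * fejerKernel L v ^ 2 =
      (∫ v in (-π)..π, f (θ - v) * fejerKernel L v ^ 2) - ∫ v in (-π)..π, f θ * fejerKernel L v ^ 2 := by
    rw [← intervalIntegral.integral_sub hI1 hI2]
    exact intervalIntegral.integral_congr fun v _ => by ring
  have hc2 : ∫ v in (-π)..π, f θ * fejerKernel L v ^ 2 = f θ * Z := by
    rw [intervalIntegral.integral_const_mul]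
  have hdiff : (1 / Z) * (∫ v in (-π)..π, f (θ - v) * fejerKernel L v ^ 2) - f θ =
      (1 / Z) * ∫ v in (-π)..π, (f (θ - v) - f θ) * fejerKernel L v ^ 2 := by
    rw [hsub, hc2]; field_simp
  rw [hdiff, abs_mul, abs_of_pos (by positivity : (0 : ℝ) < 1 / Z)]
  have hbound : |∫ v in (-π)..π, (f (θ - v) - f θ) * fejerKernel L v ^ 2| ≤ ∫ v in (-π)..π, Λ * (|v| * fejerKernel L v ^ 2) := by
    rw [← Real.norm_eq_abs]
    refine intervalIntegral.norm_integral_le_of_norm_le (by linarith) (ae_of_all _ fun v _ => ?_)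
      ((continuous_const.mul (continuous_abs.mul hK)).intervalIntegrable _ _)
    rw [Real.norm_eq_abs, abs_mul, abs_of_nonneg (by positivity : 0 ≤ fejerKernel L v ^ 2), ← mul_assoc]
    refine mul_le_mul_of_nonneg_right ?_ (by positivity)
    have := hΛ (θ - v) θ
    rwa [show θ - v - θ = -v by ring, abs_neg] at this
  rw [intervalIntegral.integral_const_mul] at hbound
  have hmom := integral_abs_mul_fejerKernel_sq_le hL
  calc 1 / Z * |∫ v in (-π)..π, (f (θ - v) - f θ) * fejerKernel L v ^ 2| ≤ 1 / Z * (Λ * (3 * π ^ 2)) :=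
        mul_le_mul_of_nonneg_left (hbound.trans (mul_le_mul_of_nonneg_left hmom hΛ0)) (by positivity)
    _ = Λ * (3 * π ^ 2) / Z := by ring
    _ ≤ Λ * (3 * π ^ 2) / (32 * L / π ^ 3) := div_le_div_of_nonneg_left (by positivity) (by positivity) hZlow
    _ = Λ * (3 * π ^ 5 / (32 * L)) := by field_simp

/-- **THE JACKSON MEAN KEEPS THE LIPSCHITZ CONSTANT** (positive kernel): `|T(a) − T(b)| ≤ Λ|a − b|`. [folklore] -/
theorem abs_jacksonMean_sub_jacksonMean_le {f : ℝ → ℝ} {Λ : ℝ} (hfc : Continuous f) (hΛ : ∀ a b, |f a - f b| ≤ Λ * |a - b|)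
    {L : ℕ} (hL : 1 ≤ L) (a b : ℝ) :
    |(1 / ∫ v in (-π)..π, fejerKernel L v ^ 2) * (∫ v in (-π)..π, f (a - v) * fejerKernel L v ^ 2) -
        (1 / ∫ v in (-π)..π, fejerKernel L v ^ 2) * (∫ v in (-π)..π, f (b - v) * fejerKernel L v ^ 2)| ≤ Λ * |a - b| := by
  have hπ := Real.pi_pos
  set Z : ℝ := ∫ v in (-π)..π, fejerKernel L v ^ 2 with hZ
  have hLr : (0 : ℝ) < L := by exact_mod_cast hL
  have hZ0 : 0 < Z := lt_of_lt_of_le (by positivity) (le_integral_fejerKernel_sq hL)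
  have hK : Continuous fun v : ℝ => fejerKernel L v ^ 2 := (continuous_fejerKernel L).pow 2
  have hfa : IntervalIntegrable (fun v => f (a - v) * fejerKernel L v ^ 2) volume (-π) π :=
    ((hfc.comp (continuous_const.sub continuous_id)).mul hK).intervalIntegrable _ _
  have hfb : IntervalIntegrable (fun v => f (b - v) * fejerKernel L v ^ 2) volume (-π) π :=
    ((hfc.comp (continuous_const.sub continuous_id)).mul hK).intervalIntegrable _ _
  rw [← mul_sub, ← intervalIntegral.integral_sub hfa hfb, abs_mul, abs_of_pos (by positivity : (0 : ℝ) < 1 / Z)]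
  have hbound : |∫ v in (-π)..π, (f (a - v) * fejerKernel L v ^ 2 - f (b - v) * fejerKernel L v ^ 2)| ≤
      ∫ v in (-π)..π, (Λ * |a - b|) * fejerKernel L v ^ 2 := by
    rw [← Real.norm_eq_abs]
    refine intervalIntegral.norm_integral_le_of_norm_le (by linarith) (ae_of_all _ fun v _ => ?_)
      ((continuous_const.mul hK).intervalIntegrable _ _)
    rw [Real.norm_eq_abs, ← sub_mul, abs_mul, abs_of_nonneg (by positivity : 0 ≤ fejerKernel L v ^ 2)]
    refine mul_le_mul_of_nonneg_right ?_ (by positivity)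
    have := hΛ (a - v) (b - v)
    rwa [show a - v - (b - v) = a - b by ring] at this
  rw [intervalIntegral.integral_const_mul] at hbound
  calc 1 / Z * |∫ v in (-π)..π, (f (a - v) * fejerKernel L v ^ 2 - f (b - v) * fejerKernel L v ^ 2)|
      ≤ 1 / Z * (Λ * |a - b| * Z) := mul_le_mul_of_nonneg_left hbound (by positivity)
    _ = Λ * |a - b| := by field_simp

end Summit.QuantumFields.YangMills.Theorems.BalabanUVNodesN19JacksonKernelMean

end
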